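import Literature.AnabelianGeometry.AbsoluteAnabelian.UnitKummerCyclotomeJunctionFundamentalNaturality
import HarnessLib

/-!
# [AbsTopIII] Prop 3.3 (i) clause (c) through THE junction is natural along EVERY isomorphism of model `TLG`-pairs:
# THE presented `TLG` class does not depend on the presentation (base field, closure, identification)

S. Mochizuki, *Topics in absolute anabelian geometry III*, §3 (bib key `MochizukiAbsTopIII2015`): Prop. 3.3 (i) p. 73
(«functorial algorithms»; clause (c): the natural `μ_Ẑ(M) ⥲ μ_Ẑ(G)` «only determined up to a `{±1}`-multiple» for
`T = TLG`), Rmk. 3.2.1 p. 73, Def. 3.1 (ii) p. 67 (morphisms of pairs cover open injections — for isomorphisms: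
isomorphisms — of the arithmetic quotients `Π ↠ G`); [AbsAnab] Prop. 1.2.1 (iv)/(vi)/(vii) pp. 10–11 (bib key
`MochizukiAbsAnab2004`).

abc-iut cell, layer L4, node AbsTopIII:Prop3.3(i), row «P33i-TLG-FUND-NATURALITY-ALL» (seat abc-iut-w4-d009 gen 5).
PROOF-ONLY, 0 defs.  `UnitKummerCyclotomeJunctionFundamentalNaturality.lean` (p446102) proved the naturality of THE `TLG`
class along GROUPIFIED `TM`-isomorphisms.  Here: along EVERY isomorphism `φ : (Π₁ ↷ k̄₁^×) ⥲ (Π₂ ↷ k̄₂^×)` of model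
`TLG`-pairs — hence for ANY two `TLG` presentations of one abstract pair.  The argument is print's: `φ_Π` covers a
Galois isomorphism `ᾱ : G_{k₁} ⥲ G_{k₂}` of TOPOLOGICAL groups (abc-iut-L6-t13's `continuous_galoisMulEquiv_of_equivariant`,
Rmk. 3.1.1: continuity is forced by `φ_M`); `φ_M` read in the algebraic closures is `ᾱ`-equivariant, hence — by
abc-iut-w5-d198 / abc-iut-L6-d1's `IsAlphaEquivariant.preservesUniformizers_or_inv` ([AbsAnab] Prop. 1.2.1 (iv): an
equivariant `ψ̄` or `inv ∘ ψ̄` carries uniformisers to uniformisers) — THE data are natural along `φ_M` or along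
`inv ∘ φ_M` (abc-iut-w6-d022's `fundamental_muZhatEquiv_congr`), i.e. THE junctions intertwine `Λ(φ_M)` with `μ_Ẑ(ᾱ)` UP TO
THE INVERSE TWIST — which the `TLG` class absorbs (twist criterion, p441869).

* `GaloisMonoidPair.Iso.exists_absGaloisIso_of_tlgIso` — every isomorphism of model `TLG`-pairs covers a TOPOLOGICAL
  isomorphism `ᾱ : G_{k₁} ≃ₜ* G_{k₂}` (`ᾱ ∘ augGal₁ = augGal₂ ∘ φ_Π`; an `∃`, no definition);
* `GaloisMonoidPair.Iso.isAlphaEquivariant_of_tlgIso` — `φ_M` read in the algebraic closures is `ᾱ`-equivariant for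
  every `ᾱ` covered by `φ_Π`;
* `GaloisMonoidPair.Iso.cyclotomeUnitsEquivMuZhatFund_tlgIso` — THE junctions intertwine `Λ(φ_M)` with `μ_Ẑ(ᾱ)` EXACTLY
  OR UP TO INVERSION;
* **`GaloisMonoidPair.TLGPresentation.unitKummerTheoryMuZhatFund_cycIsoClass_indep`** — for ANY two `TLG` presentations
  `π₁` (by `(k₁, k̄₁)`) and `π₂` (by `(k₂, k̄₂)`) of an abstract pair `P` and ANY Galois isomorphism `ᾱ` covered by the change
  of presentation `π₂⁻¹ ∘ π₁`, THE class of `π₁` re-targeted along the group-theoretic `μ_Ẑ(ᾱ)` IS THE class of `π₂`;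
  with `…_indep'` (the `∃ ᾱ` form): **clause (c) for `TLG` through THE junction is presentation-independent across base
  fields — print's «functorial algorithm» on isomorphisms, at print strength, unconditionally.**

ELABORATION NOTE: class equalities are `@Eq (Set (μ_Ẑ(M) ≃* μ_Ẑ(G_k))) lhs rhs` (type first) and are proved by mutual
inclusion through the torsor axioms (see p441869's note).  HONEST FRAMING: classical (local class field theory + Kummer
theory at OUR model objects); nothing here bears on [IUTchIII] Cor. 3.12; no side taken; typed ≠ proved.
-/

noncomputable section

open scoped nonZeroDivisors

namespace Literature.AnabelianGeometry.AbsoluteAnabelian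

open Field
open Literature.NumberTheory.GaloisRepresentations

/-- `Λ(e ≫ inv) η = (Λ(e) η)⁻¹` (componentwise). [cite: MochizukiAbsTopIII2015, Remark 3.2.1 p.73] -/
theorem cyclotome_map_trans_inv {A B : Type*} [CommGroup A] [CommGroup B] (e : A ≃* B)
    (η : EtaleTheta.cyclotome A) :
    EtaleTheta.cyclotome.map (e.trans (MulEquiv.inv B)).toMonoidHom η = (EtaleTheta.cyclotome.map e.toMonoidHom η)⁻¹ :=
  Subtype.ext (funext fun _ => rfl)

namespace GaloisMonoidPair.Iso

variable {C₁ C₂ : MLFClosure.{0}} {D₁ : ModelMLFGaloisData C₁.k C₁.K} {D₂ : ModelMLFGaloisData C₂.k C₂.K}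
  (φ : GaloisMonoidPair.Iso D₁.tlgPair D₂.tlgPair)

/-! ### §1 The Galois isomorphism covered by an isomorphism of model `TLG`-pairs (topological, as an `∃`) -/

/-- `φ_Π` carries `Ker ε₁` onto `Ker ε₂` (the arithmetic kernel of the model `TLG`-pair is `Ker ε_k`).
[cite: MochizukiAbsTopIII2015, Definition 3.1 (ii) p.67] -/
theorem tlg_map_ker_aug : D₁.aug.ker.map φ.isoPi.toMulEquiv.toMonoidHom = D₂.aug.ker := by
  rw [← ModelMLFGaloisData.tlgPair_actionKer C₁ D₁, ← ModelMLFGaloisData.tlgPair_actionKer C₂ D₂]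
  exact φ.map_actionKer

/-- The values of the model `TLG` action: `(g • x : k̄^×) = ε_k(g) x`. [cite: MochizukiAbsTopIII2015, Definition 3.1 (i) p.67] -/
theorem coe_tlgPair_smul (C : MLFClosure.{0}) (D : ModelMLFGaloisData C.k C.K) (g : D.tlgPair.Pi) (x : D.tlgPair.M) :
    (((g • x : D.tlgPair.M) : (C.K)⁰) : C.K) = D.aug g (x : C.K) := rfl

/-- **Every isomorphism of model `TLG`-pairs covers a TOPOLOGICAL isomorphism `ᾱ : G_{k₁} ≃ₜ* G_{k₂}`** of the absolute
Galois groups (`ᾱ ∘ augGal₁ = augGal₂ ∘ φ_Π`): the abstract isomorphism of the arithmetic quotients exists since `φ_Π`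
respects the kernels, and is continuous in both directions because `φ_M` is equivariant along it (Rmk. 3.1.1,
abc-iut-L6-t13). [cite: MochizukiAbsTopIII2015, Definition 3.1 (ii) p.67] -/
theorem exists_absGaloisIso_of_tlgIso :
    ∃ α : absoluteGaloisGroup C₁.k ≃ₜ* absoluteGaloisGroup C₂.k,
      ∀ g : D₁.Pi, α (D₁.augGal C₁ g) = D₂.augGal C₂ (φ.isoPi g) := by
  obtain ⟨α₀, hα₀⟩ := ModelMLFGaloisData.exists_galoisMulEquiv_of_map_ker_eq D₁ D₂ φ.isoPi φ.tlg_map_ker_aug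
  -- adapted from abc-iut-L4-t2's `MLFGaloisTMIsoUnitsTransport` §1 (there for `f.tlgIso` of a `TM`-isomorphism `f`)
  have hc : Continuous α₀ := by
    refine continuous_galoisMulEquiv_of_equivariant C₁ C₂ α₀ φ.isoM fun σ x y hxy => ?_
    obtain ⟨g, rfl⟩ := D₁.aug_surjective σ
    have hxy' : y = (g : D₁.tlgPair.Pi) • x := Subtype.ext hxy
    rw [hxy', φ.smul_comm, coe_tlgPair_smul, hα₀]
  have hαs : ∀ h, α₀.symm (D₂.aug h) = D₁.aug (φ.isoPi.symm h) := fun h => by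
    rw [MulEquiv.symm_apply_eq, hα₀, ContinuousMulEquiv.apply_symm_apply]
  have hc' : Continuous α₀.symm := by
    refine continuous_galoisMulEquiv_of_equivariant C₂ C₁ α₀.symm φ.isoM.symm fun τ x y hxy => ?_
    obtain ⟨h, rfl⟩ := D₂.aug_surjective τ
    have hxy' : y = (h : D₂.tlgPair.Pi) • x := Subtype.ext hxy
    rw [hxy', GaloisMonoidPair.Iso.symm_smul_comm, coe_tlgPair_smul, hαs]
  let α₁ : (C₁.K ≃ₐ[C₁.k] C₁.K) ≃ₜ* (C₂.K ≃ₐ[C₂.k] C₂.K) :=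
    { α₀ with continuous_toFun := hc, continuous_invFun := hc' }
  refine ⟨((algEquivContinuousMulEquivAbsoluteGaloisGroup C₁.k C₁.K).symm.trans α₁).trans
      (algEquivContinuousMulEquivAbsoluteGaloisGroup C₂.k C₂.K), fun g => ?_⟩
  show algEquivContinuousMulEquivAbsoluteGaloisGroup C₂.k C₂.K (α₀
      ((algEquivContinuousMulEquivAbsoluteGaloisGroup C₁.k C₁.K).symm
        (algEquivContinuousMulEquivAbsoluteGaloisGroup C₁.k C₁.K (D₁.aug g)))) =
    algEquivContinuousMulEquivAbsoluteGaloisGroup C₂.k C₂.K (D₂.aug (φ.isoPi g))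
  rw [ContinuousMulEquiv.symm_apply_apply, hα₀]

/-! ### §2 `φ_M` read in the algebraic closures is `ᾱ`-equivariant -/

/-- `φ_M` on units `k̄₁ˣ ⥲ k̄₂ˣ` (through `(k̄)⁰ ≃ k̄ˣ`) is `φ_Π`-equivariant. [cite: MochizukiAbsTopIII2015, Definition 3.1 (ii) p.67] -/
theorem unitsOfTlgIso_smul (g : D₁.Pi) (u : (C₁.K)ˣ) :
    ((nonZeroDivisorsEquivUnits : (C₁.K)⁰ ≃* (C₁.K)ˣ).symm.trans
        (φ.isoM.trans (nonZeroDivisorsEquivUnits : (C₂.K)⁰ ≃* (C₂.K)ˣ))) (g • u) =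
      φ.isoPi g • ((nonZeroDivisorsEquivUnits : (C₁.K)⁰ ≃* (C₁.K)ˣ).symm.trans
        (φ.isoM.trans (nonZeroDivisorsEquivUnits : (C₂.K)⁰ ≃* (C₂.K)ˣ))) u := by
  have h1 : (nonZeroDivisorsEquivUnits : (C₁.K)⁰ ≃* (C₁.K)ˣ).symm (g • u) =
      (g : D₁.tlgPair.Pi) • (nonZeroDivisorsEquivUnits : (C₁.K)⁰ ≃* (C₁.K)ˣ).symm u :=
    Subtype.ext rfl
  apply Units.ext
  change (((nonZeroDivisorsEquivUnits : (C₂.K)⁰ ≃* (C₂.K)ˣ) (φ.isoM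
      ((nonZeroDivisorsEquivUnits : (C₁.K)⁰ ≃* (C₁.K)ˣ).symm (g • u))) : (C₂.K)ˣ) : C₂.K) =
    D₂.aug (φ.isoPi g) • (((nonZeroDivisorsEquivUnits : (C₂.K)⁰ ≃* (C₂.K)ˣ) (φ.isoM
      ((nonZeroDivisorsEquivUnits : (C₁.K)⁰ ≃* (C₁.K)ˣ).symm u)) : (C₂.K)ˣ) : C₂.K)
  rw [h1, φ.smul_comm]
  rfl

/-- **`φ_M` read in the algebraic closures, `ψ̄ := (k₁^alg ≃ k̄₁) ≫ φ_M ≫ (k̄₂ ≃ k₂^alg)` on units, is `ᾱ`-equivariant** for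
every Galois isomorphism `ᾱ` covered by `φ_Π` ([AbsAnab] Prop. 1.2.1 (vi) «Galois-equivariant with respect to `α`»).
[cite: MochizukiAbsAnab2004, Prop 1.2.1 (vi) p.10] -/
theorem isAlphaEquivariant_of_tlgIso (α : absoluteGaloisGroup C₁.k ≃ₜ* absoluteGaloisGroup C₂.k)
    (hα : ∀ g : D₁.Pi, α (D₁.augGal C₁ g) = D₂.augGal C₂ (φ.isoPi g)) :
    Prop121vii.IsAlphaEquivariant α
      (((Units.mapEquiv (C₁.toAlgClosure.symm : AlgebraicClosure C₁.k ≃* C₁.K)).trans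
          ((nonZeroDivisorsEquivUnits : (C₁.K)⁰ ≃* (C₁.K)ˣ).symm.trans
            (φ.isoM.trans (nonZeroDivisorsEquivUnits : (C₂.K)⁰ ≃* (C₂.K)ˣ)))).trans
        (Units.mapEquiv (C₂.toAlgClosure : C₂.K ≃* AlgebraicClosure C₂.k))) := by
  -- adapted from abc-iut-L4-t2's `isAlphaEquivariant` (MLFGaloisTMIsoUnitsTransport.lean)
  intro σ x
  obtain ⟨g, rfl⟩ := augGal_surjective C₁ D₁ σ
  apply (Units.mapEquiv (C₂.toAlgClosure.symm : AlgebraicClosure C₂.k ≃* C₂.K)).injective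
  have hread : ∀ v : (AlgebraicClosure C₁.k)ˣ,
      Units.mapEquiv (C₂.toAlgClosure.symm : AlgebraicClosure C₂.k ≃* C₂.K)
        ((((Units.mapEquiv (C₁.toAlgClosure.symm : AlgebraicClosure C₁.k ≃* C₁.K)).trans
          ((nonZeroDivisorsEquivUnits : (C₁.K)⁰ ≃* (C₁.K)ˣ).symm.trans
            (φ.isoM.trans (nonZeroDivisorsEquivUnits : (C₂.K)⁰ ≃* (C₂.K)ˣ)))).trans
          (Units.mapEquiv (C₂.toAlgClosure : C₂.K ≃* AlgebraicClosure C₂.k))) v) =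
        ((nonZeroDivisorsEquivUnits : (C₁.K)⁰ ≃* (C₁.K)ˣ).symm.trans
          (φ.isoM.trans (nonZeroDivisorsEquivUnits : (C₂.K)⁰ ≃* (C₂.K)ˣ)))
          (Units.map (C₁.toAlgClosure.symm : AlgebraicClosure C₁.k →* C₁.K) v) :=
    fun v => Units.ext (AlgEquiv.symm_apply_apply C₂.toAlgClosure _)
  have hmapEq : ∀ w : (AlgebraicClosure C₂.k)ˣ,
      Units.mapEquiv (C₂.toAlgClosure.symm : AlgebraicClosure C₂.k ≃* C₂.K) w =
        Units.map (C₂.toAlgClosure.symm : AlgebraicClosure C₂.k →* C₂.K) w := fun w => Units.ext rfl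
  rw [hread, hmapEq, hα, map_toAlgClosure_symm_smul, map_toAlgClosure_symm_smul, unitsOfTlgIso_smul,
    ← hmapEq, hread]

/-! ### §3 THE junctions intertwine `Λ(φ_M)` with `μ_Ẑ(ᾱ)` — exactly or up to inversion -/

/-- Components: THE junction applied after `Λ(φ_M)` versus `Λ(ψ̄)` applied after `Λ(k̄₁ ≃ k₁^alg)` — the bookkeeping
identity `Λ(k̄₂ ≃ k₂^alg) ∘ Λ(φ_M) = Λ(ψ̄) ∘ Λ(k̄₁ ≃ k₁^alg)` on `Λ(k̄₁ˣ)`. [cite: MochizukiAbsTopIII2015, Remark 3.2.1 p.73] -/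
theorem cyclotomeCongr_closure_map_unitsOfTlgIso (ξ : EtaleTheta.cyclotome (C₁.K)ˣ) :
    MonoidKummerTheory.cyclotomeCongr C₂.closureMulEquivAlgClosure
        (EtaleTheta.cyclotome.map ((nonZeroDivisorsEquivUnits : (C₁.K)⁰ ≃* (C₁.K)ˣ).symm.trans
          (φ.isoM.trans (nonZeroDivisorsEquivUnits : (C₂.K)⁰ ≃* (C₂.K)ˣ))).toMonoidHom ξ) =
      EtaleTheta.cyclotome.map
        (((Units.mapEquiv (C₁.toAlgClosure.symm : AlgebraicClosure C₁.k ≃* C₁.K)).trans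
            ((nonZeroDivisorsEquivUnits : (C₁.K)⁰ ≃* (C₁.K)ˣ).symm.trans
              (φ.isoM.trans (nonZeroDivisorsEquivUnits : (C₂.K)⁰ ≃* (C₂.K)ˣ)))).trans
          (Units.mapEquiv (C₂.toAlgClosure : C₂.K ≃* AlgebraicClosure C₂.k))).toMonoidHom
        (MonoidKummerTheory.cyclotomeCongr C₁.closureMulEquivAlgClosure ξ) := by
  refine Subtype.ext (funext fun n => Units.ext ?_)
  change C₂.toAlgClosure ((φ.isoM ((nonZeroDivisorsEquivUnits : (C₁.K)⁰ ≃* (C₁.K)ˣ).symm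
      ((ξ : ℕ+ → (C₁.K)ˣ) n)) : (C₂.K)⁰) : C₂.K) =
    C₂.toAlgClosure ((φ.isoM ((nonZeroDivisorsEquivUnits : (C₁.K)⁰ ≃* (C₁.K)ˣ).symm
      (Units.map (C₁.toAlgClosure.symm : AlgebraicClosure C₁.k →* C₁.K)
        (Units.map (C₁.toAlgClosure : C₁.K →* AlgebraicClosure C₁.k) ((ξ : ℕ+ → (C₁.K)ˣ) n)))) : (C₂.K)⁰) : C₂.K)
  congr 4
  exact Units.ext (C₁.toAlgClosure.symm_apply_apply _).symm

/-- **THE junctions intertwine `Λ(φ_M)` with `μ_Ẑ(ᾱ)`, EXACTLY OR UP TO INVERSION**: for every isomorphism `φ` of model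
`TLG`-pairs and every Galois isomorphism `ᾱ` covered by `φ_Π`, either
`Fund₂ (Λ(φ_M) ξ) = μ_Ẑ(ᾱ) (Fund₁ ξ)` for all `ξ ∈ Λ(k̄₁ˣ)`, or `Fund₂ (Λ(φ_M) ξ) = (μ_Ẑ(ᾱ) (Fund₁ ξ))⁻¹` for all `ξ` —
according as `φ_M` or `inv ∘ φ_M` carries uniformisers to uniformisers ([AbsAnab] Prop. 1.2.1 (iv),
`IsAlphaEquivariant.preservesUniformizers_or_inv`; then (vii), `fundamental_muZhatEquiv_congr`).
[cite: MochizukiAbsTopIII2015, Remark 3.2.1 p.73] -/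
theorem cyclotomeUnitsEquivMuZhatFund_tlgIso (α : absoluteGaloisGroup C₁.k ≃ₜ* absoluteGaloisGroup C₂.k)
    (hα : ∀ g : D₁.Pi, α (D₁.augGal C₁ g) = D₂.augGal C₂ (φ.isoPi g)) :
    (∀ ξ : EtaleTheta.cyclotome (C₁.K)ˣ,
      C₂.cyclotomeUnitsEquivMuZhatFund (EtaleTheta.cyclotome.map ((nonZeroDivisorsEquivUnits : (C₁.K)⁰ ≃* (C₁.K)ˣ).symm.trans
          (φ.isoM.trans (nonZeroDivisorsEquivUnits : (C₂.K)⁰ ≃* (C₂.K)ˣ))).toMonoidHom ξ) =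
        muZhat.congr α (C₁.cyclotomeUnitsEquivMuZhatFund ξ)) ∨
    (∀ ξ : EtaleTheta.cyclotome (C₁.K)ˣ,
      C₂.cyclotomeUnitsEquivMuZhatFund (EtaleTheta.cyclotome.map ((nonZeroDivisorsEquivUnits : (C₁.K)⁰ ≃* (C₁.K)ˣ).symm.trans
          (φ.isoM.trans (nonZeroDivisorsEquivUnits : (C₂.K)⁰ ≃* (C₂.K)ˣ))).toMonoidHom ξ) =
        (muZhat.congr α (C₁.cyclotomeUnitsEquivMuZhatFund ξ))⁻¹) := by
  have hψ := φ.isAlphaEquivariant_of_tlgIso α hα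
  have hy : ∀ ξ : EtaleTheta.cyclotome (C₁.K)ˣ,
      (TorsionReciprocityData.fundamental C₁.k).muZhatEquiv (C₁.cyclotomeUnitsEquivMuZhatFund ξ) =
        MonoidKummerTheory.cyclotomeCongr C₁.closureMulEquivAlgClosure ξ :=
    fun ξ => MulEquiv.apply_symm_apply _ _
  rcases hψ.preservesUniformizers_or_inv with hU | hU
  · left
    intro ξ
    have key := TorsionReciprocityData.fundamental_muZhatEquiv_congr α hψ hU (C₁.cyclotomeUnitsEquivMuZhatFund ξ)
    change (TorsionReciprocityData.fundamental C₂.k).muZhatEquiv.symm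
        (MonoidKummerTheory.cyclotomeCongr C₂.closureMulEquivAlgClosure _) = _
    rw [MulEquiv.symm_apply_eq, key, hy, φ.cyclotomeCongr_closure_map_unitsOfTlgIso]
  · right
    intro ξ
    have key := TorsionReciprocityData.fundamental_muZhatEquiv_congr α hψ.trans_inv hU
      (C₁.cyclotomeUnitsEquivMuZhatFund ξ)
    change (TorsionReciprocityData.fundamental C₂.k).muZhatEquiv.symm
        (MonoidKummerTheory.cyclotomeCongr C₂.closureMulEquivAlgClosure _) = _
    rw [MulEquiv.symm_apply_eq, map_inv, key, hy, cyclotome_map_trans_inv, inv_inv,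
      φ.cyclotomeCongr_closure_map_unitsOfTlgIso]

end GaloisMonoidPair.Iso

/-! ### §4 THE presented `TLG` class is independent of the presentation -/

namespace GaloisMonoidPair.TLGPresentation

variable {P : GaloisMonoidPair.{0}} (π₁ π₂ : P.TLGPresentation)

/-- The cyclotome square of the change of presentation `π₂⁻¹ ∘ π₁` read on units: for `ζ ∈ μ_Ẑ(M)`,
`Λ-units₂ (μ_Ẑ(π₂⁻¹) ζ) = Λ((π₂⁻¹π₁)_M) (Λ-units₁ (μ_Ẑ(π₁⁻¹) ζ))`. [cite: MochizukiAbsTopIII2015, Definition 3.1 (v) p.69] -/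
theorem cyclotomeNonZeroDivisorsEquiv_changeOfPresentation (ζ : cyclotome P.M) :
    π₂.C.cyclotomeNonZeroDivisorsEquiv (MonoidKummerTheory.cyclotomeCongr π₂.iso.isoM.symm ζ) =
      EtaleTheta.cyclotome.map ((nonZeroDivisorsEquivUnits : (π₁.C.K)⁰ ≃* (π₁.C.K)ˣ).symm.trans
          ((π₁.iso.trans π₂.iso.symm).isoM.trans (nonZeroDivisorsEquivUnits : (π₂.C.K)⁰ ≃* (π₂.C.K)ˣ))).toMonoidHom
        (π₁.C.cyclotomeNonZeroDivisorsEquiv (MonoidKummerTheory.cyclotomeCongr π₁.iso.isoM.symm ζ)) := by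
  refine Subtype.ext (funext fun n => Units.ext ?_)
  have h1 : (nonZeroDivisorsEquivUnits : (π₁.C.K)⁰ ≃* (π₁.C.K)ˣ).symm
      (((π₁.C.cyclotomeNonZeroDivisorsEquiv (MonoidKummerTheory.cyclotomeCongr π₁.iso.isoM.symm ζ) :
        EtaleTheta.cyclotome (π₁.C.K)ˣ) : ℕ+ → (π₁.C.K)ˣ) n) =
      π₁.iso.isoM.symm (((ζ : ℕ+ → (P.M)ˣ) n : (P.M)ˣ) : P.M) := Subtype.ext rfl
  change ((π₂.iso.isoM.symm (((ζ : ℕ+ → (P.M)ˣ) n : (P.M)ˣ) : P.M) : (π₂.C.K)⁰) : π₂.C.K) =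
    (((nonZeroDivisorsEquivUnits : (π₂.C.K)⁰ ≃* (π₂.C.K)ˣ)
      ((π₁.iso.trans π₂.iso.symm).isoM ((nonZeroDivisorsEquivUnits : (π₁.C.K)⁰ ≃* (π₁.C.K)ˣ).symm
        (((π₁.C.cyclotomeNonZeroDivisorsEquiv (MonoidKummerTheory.cyclotomeCongr π₁.iso.isoM.symm ζ) :
          EtaleTheta.cyclotome (π₁.C.K)ˣ) : ℕ+ → (π₁.C.K)ˣ) n))) : (π₂.C.K)ˣ) : π₂.C.K)
  rw [h1]
  change _ = ((π₂.iso.isoM.symm (π₁.iso.isoM (π₁.iso.isoM.symm (((ζ : ℕ+ → (P.M)ˣ) n : (P.M)ˣ) : P.M))) :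
    (π₂.C.K)⁰) : π₂.C.K)
  rw [MulEquiv.apply_symm_apply]

/-- **Presentation-independence of Prop 3.3 (i) clause (c) (`TLG`, THE junction) across base fields**: for ANY two
`TLG` presentations `π₁` (by `(k₁, k̄₁)`) and `π₂` (by `(k₂, k̄₂)`) of an abstract MLF-Galois `TLG`-pair `P` and ANY
Galois isomorphism `ᾱ : G_{k₁} ≃ₜ* G_{k₂}` covered by the change of presentation `π₂⁻¹ ∘ π₁` (one exists:
`GaloisMonoidPair.Iso.exists_absGaloisIso_of_tlgIso`), THE class of `π₁` re-targeted along the group-theoretic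
`μ_Ẑ(ᾱ)` IS THE class of `π₂` — print's «functorial algorithm» for clause (c) on isomorphisms, unconditionally.
[cite: MochizukiAbsTopIII2015, Proposition 3.3 (i) p.73] -/
theorem unitKummerTheoryMuZhatFund_cycIsoClass_indep (α : absoluteGaloisGroup π₁.C.k ≃ₜ* absoluteGaloisGroup π₂.C.k)
    (hα : ∀ g : π₁.D.Pi, α (π₁.D.augGal π₁.C g) = π₂.D.augGal π₂.C ((π₁.iso.trans π₂.iso.symm).isoPi g)) :
    @Eq (Set (cyclotome P.M ≃* muZhat (absoluteGaloisGroup π₂.C.k)))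
      ((π₁.unitKummerTheoryMuZhatFund.mapCyclotome (muZhat.congr α)).cycIsoClass)
      π₂.unitKummerTheoryMuZhatFund.cycIsoClass := by
  have hnat := GaloisMonoidPair.Iso.cyclotomeUnitsEquivMuZhatFund_tlgIso (π₁.iso.trans π₂.iso.symm) α hα
  have hsq := cyclotomeNonZeroDivisorsEquiv_changeOfPresentation π₁ π₂
  -- the reference member of THE class of `π₂`: `μ_Ẑ(M) ⥲ μ_Ẑ(k̄₂^×) ⥲ Λ(k̄₂ˣ) ⥲ μ_Ẑ(G_{k₂})`
  have hB : ((MonoidKummerTheory.cyclotomeCongr π₂.iso.isoM.symm).trans π₂.C.cyclotomeNonZeroDivisorsEquiv).trans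
        π₂.C.cyclotomeUnitsEquivMuZhatFund ∈ π₂.unitKummerTheoryMuZhatFund.cycIsoClass :=
    ⟨(MonoidKummerTheory.cyclotomeCongr π₂.iso.isoM.symm).trans π₂.C.cyclotomeNonZeroDivisorsEquiv,
      ⟨π₂.C.cyclotomeNonZeroDivisorsEquiv, Or.inl rfl, rfl⟩, rfl⟩
  -- the corresponding member of the re-targeted class of `π₁`
  have hx : (((MonoidKummerTheory.cyclotomeCongr π₁.iso.isoM.symm).trans π₁.C.cyclotomeNonZeroDivisorsEquiv).trans
        π₁.C.cyclotomeUnitsEquivMuZhatFund).trans (muZhat.congr α) ∈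
      (π₁.unitKummerTheoryMuZhatFund.mapCyclotome (muZhat.congr α)).cycIsoClass :=
    ⟨((MonoidKummerTheory.cyclotomeCongr π₁.iso.isoM.symm).trans π₁.C.cyclotomeNonZeroDivisorsEquiv).trans
        π₁.C.cyclotomeUnitsEquivMuZhatFund,
      ⟨(MonoidKummerTheory.cyclotomeCongr π₁.iso.isoM.symm).trans π₁.C.cyclotomeNonZeroDivisorsEquiv,
        ⟨π₁.C.cyclotomeNonZeroDivisorsEquiv, Or.inl rfl, rfl⟩, rfl⟩, rfl⟩
  -- the reference member lies in the re-targeted class of `π₁`: it IS the member above, or its inverse twist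
  have hA : ((MonoidKummerTheory.cyclotomeCongr π₂.iso.isoM.symm).trans π₂.C.cyclotomeNonZeroDivisorsEquiv).trans
        π₂.C.cyclotomeUnitsEquivMuZhatFund ∈
      (π₁.unitKummerTheoryMuZhatFund.mapCyclotome (muZhat.congr α)).cycIsoClass := by
    rcases hnat with h | h
    · have heq : (((MonoidKummerTheory.cyclotomeCongr π₁.iso.isoM.symm).trans π₁.C.cyclotomeNonZeroDivisorsEquiv).trans
            π₁.C.cyclotomeUnitsEquivMuZhatFund).trans (muZhat.congr α) =
          ((MonoidKummerTheory.cyclotomeCongr π₂.iso.isoM.symm).trans π₂.C.cyclotomeNonZeroDivisorsEquiv).trans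
            π₂.C.cyclotomeUnitsEquivMuZhatFund :=
        MulEquiv.ext fun ζ => by
          change muZhat.congr α (π₁.C.cyclotomeUnitsEquivMuZhatFund (π₁.C.cyclotomeNonZeroDivisorsEquiv
              (MonoidKummerTheory.cyclotomeCongr π₁.iso.isoM.symm ζ))) =
            π₂.C.cyclotomeUnitsEquivMuZhatFund (π₂.C.cyclotomeNonZeroDivisorsEquiv
              (MonoidKummerTheory.cyclotomeCongr π₂.iso.isoM.symm ζ))
          rw [hsq, h]
      exact heq ▸ hx
    · have heq : (MulEquiv.inv (cyclotome P.M)).trans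
            ((((MonoidKummerTheory.cyclotomeCongr π₁.iso.isoM.symm).trans π₁.C.cyclotomeNonZeroDivisorsEquiv).trans
              π₁.C.cyclotomeUnitsEquivMuZhatFund).trans (muZhat.congr α)) =
          ((MonoidKummerTheory.cyclotomeCongr π₂.iso.isoM.symm).trans π₂.C.cyclotomeNonZeroDivisorsEquiv).trans
            π₂.C.cyclotomeUnitsEquivMuZhatFund :=
        MulEquiv.ext fun ζ => by
          change muZhat.congr α (π₁.C.cyclotomeUnitsEquivMuZhatFund (π₁.C.cyclotomeNonZeroDivisorsEquiv
              (MonoidKummerTheory.cyclotomeCongr π₁.iso.isoM.symm ζ⁻¹))) =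
            π₂.C.cyclotomeUnitsEquivMuZhatFund (π₂.C.cyclotomeNonZeroDivisorsEquiv
              (MonoidKummerTheory.cyclotomeCongr π₂.iso.isoM.symm ζ))
          rw [map_inv, map_inv, map_inv, map_inv, hsq, h]
      exact heq ▸ UnitKummerTheory.inv_trans_mem_cycIsoClass _ hx
  -- two `TLG` classes (each the `{±1}`-orbit of any member) with a common member coincide
  refine Set.Subset.antisymm (fun e he => ?_) (fun e he => ?_)
  · obtain ⟨u, hu, hcomp⟩ := UnitKummerTheory.cycIsoClass_torsor _ _ hA e he
    obtain ⟨e', he', hcomp'⟩ := UnitKummerTheory.cycIsoClass_full _ _ hB u hu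
    have heq : (e' : cyclotome P.M ≃* muZhat (absoluteGaloisGroup π₂.C.k)) = e :=
      MulEquiv.ext fun ζ => (hcomp' ζ).trans (hcomp ζ).symm
    exact heq ▸ he'
  · obtain ⟨u, hu, hcomp⟩ := UnitKummerTheory.cycIsoClass_torsor _ _ hB e he
    obtain ⟨e', he', hcomp'⟩ := UnitKummerTheory.cycIsoClass_full _ _ hA u hu
    have heq : (e' : cyclotome P.M ≃* muZhat (absoluteGaloisGroup π₂.C.k)) = e :=
      MulEquiv.ext fun ζ => (hcomp' ζ).trans (hcomp ζ).symm
    exact heq ▸ he'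

/-- **THE `TLG` class is presentation-independent (∃-form)**: for any two `TLG` presentations of an abstract pair there is a
TOPOLOGICAL isomorphism `ᾱ : G_{k₁} ≃ₜ* G_{k₂}` covered by the change of presentation, and re-targeting THE class of `π₁`
along the group-theoretic `μ_Ẑ(ᾱ)` gives THE class of `π₂`. [cite: MochizukiAbsTopIII2015, Proposition 3.3 (i) p.73] -/
theorem unitKummerTheoryMuZhatFund_cycIsoClass_indep' :
    ∃ α : absoluteGaloisGroup π₁.C.k ≃ₜ* absoluteGaloisGroup π₂.C.k,
      (∀ g : π₁.D.Pi, α (π₁.D.augGal π₁.C g) = π₂.D.augGal π₂.C (π₂.iso.isoPi.symm (π₁.iso.isoPi g))) ∧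
      @Eq (Set (cyclotome P.M ≃* muZhat (absoluteGaloisGroup π₂.C.k)))
        ((π₁.unitKummerTheoryMuZhatFund.mapCyclotome (muZhat.congr α)).cycIsoClass)
        π₂.unitKummerTheoryMuZhatFund.cycIsoClass := by
  obtain ⟨α, hα⟩ := (π₁.iso.trans π₂.iso.symm).exists_absGaloisIso_of_tlgIso
  exact ⟨α, hα, unitKummerTheoryMuZhatFund_cycIsoClass_indep π₁ π₂ α hα⟩

end GaloisMonoidPair.TLGPresentation

end Literature.AnabelianGeometry.AbsoluteAnabelian

end
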